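import Mathlib
import Summits.Ventures.PercRepro2.CoinChainQstar

/-!
# The universal PURE chain whenever the ENTERED part of the gate functional is nonnegative
(blind cell PercRepro2, night-2 g23; proofs/NIGHT2-DARC.md §63)

Pure chain (`ent = ∅`), moments as in `pureChain_functional_nonneg_of_Qstar`: world 0 `a0 a1 a2`,
world-1 `R`-law `b0 b1 b2`, gate `g0 g1 g2 g12`, ideal mass and moments `m xI yI`.  The cleared
world-1 functional `U111 = ∑_W G¹(W)(b0 x_W − b1)(b0 y_W − b2)` splits into its IDEAL part
`Iₚ = ∑_{W ∩ ent' = ∅} ν c (b0 x − b1)(b0 y − b2)` and its ENTERED part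
`Dₚ = ∑_{W meets ent'} ν d' (b0 x − b1)(b0 y − b2)`.  The ideal part is at least the product of the
two ideal shifts, `m·Iₚ ≥ (m b1 − b0 xI)(m b2 − b0 yI)` (FKG on the ideal, a sublattice), and the
one-marker bound `one_marker_bound` in its global form together with `ideal_mean` gives
`(b0 − g0)·|Δ| ≤ a0²·(m b1 − b0 xI)(m b2 − b0 yI)/m` in the anti-aligned pattern — so the ideal
part alone pays the pivotal need, and (Q′) `a0²·U111 + (b0 − g0)·Δ ≥ 0` holds as soon as the
entered part `Dₚ` is nonnegative.  THEOREM `pureChain_functional_nonneg_of_enteredPart`: under the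
head hypotheses, `d' ≤ d`, positive world masses and a positive ideal mass, `Dₚ ≥ 0` implies the
pure chain functional at EVERY `ρ ∈ [0, 1]` for every pair of nonnegative increasing markers.
This is the exact form of the observation of §62.7′(a): `S_D ≥ 0` fails in 10–20 % of the real
heads, and every failure of the route «the ideal term pays» is a failure of `Dₚ ≥ 0`.
-/

namespace Summit.Ventures.PercRepro2.Coin

open Classical

section EnteredAlg

variable {R : Type*} [Field R] [LinearOrder R] [IsStrictOrderedRing R]

/-- (Q′) from a nonnegative entered part: the algebra.  `Ip` is the ideal part, `Dp` the
entered part of `U111 = Ip + Dp`; `hIp` is the ideal FKG bound, `hOMx`/`hOMy` the one-marker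
bounds in global form, `hidx`/`hidy` the ideal means below the world-0 means, `hqx`/`hqy` the
ideal means below the world-1 means. -/
lemma qprime_of_enteredPart_alg (a0 a1 a2 b0 b1 b2 g0 m xI yI Ip Dp : R)
    (hm : 0 < m) (ha0 : 0 ≤ a0) (hb0 : 0 ≤ b0) (hP : 0 ≤ b0 - g0) (hDp : 0 ≤ Dp)
    (hIp : (m * b1 - b0 * xI) * (m * b2 - b0 * yI) ≤ m * Ip)
    (hOMx : (b0 - g0) * (b0 * a1 - a0 * b1) ≤ a0 * (m * b1 - b0 * xI))
    (hOMy : (b0 - g0) * (b0 * a2 - a0 * b2) ≤ a0 * (m * b2 - b0 * yI))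
    (hidx : a0 * xI ≤ m * a1) (hidy : a0 * yI ≤ m * a2)
    (hqx : b0 * xI ≤ m * b1) (hqy : b0 * yI ≤ m * b2) :
    0 ≤ a0 ^ 2 * (Ip + Dp) + (b0 - g0) * ((b0 * a1 - a0 * b1) * (b0 * a2 - a0 * b2)) := by
  have hx1 : 0 ≤ m * b1 - b0 * xI := by linarith
  have hy1 : 0 ≤ m * b2 - b0 * yI := by linarith
  have hprod : 0 ≤ (m * b1 - b0 * xI) * (m * b2 - b0 * yI) := mul_nonneg hx1 hy1
  have hmIp : 0 ≤ m * Ip := le_trans hprod hIp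
  have hIp0 : 0 ≤ Ip := (mul_nonneg_iff_of_pos_left hm).mp hmIp
  have hDp' : 0 ≤ a0 ^ 2 * Dp := mul_nonneg (sq_nonneg a0) hDp
  have hA2 : 0 ≤ a0 ^ 2 := sq_nonneg a0
  -- the ideal part against the need, by the sign of the two world shifts
  have key : 0 ≤ a0 ^ 2 * Ip + (b0 - g0) * ((b0 * a1 - a0 * b1) * (b0 * a2 - a0 * b2)) := by
    rcases le_or_gt 0 ((b0 * a1 - a0 * b1) * (b0 * a2 - a0 * b2)) with hEE | hEE
    · have h1 : 0 ≤ (b0 - g0) * ((b0 * a1 - a0 * b1) * (b0 * a2 - a0 * b2)) := mul_nonneg hP hEE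
      have h2 : 0 ≤ a0 ^ 2 * Ip := mul_nonneg hA2 hIp0
      linarith
    · -- anti-aligned: exactly one of the two world shifts is negative
      have h4 : a0 * (m * b1 - b0 * xI) * (a0 * (m * b2 - b0 * yI)) ≤ a0 ^ 2 * (m * Ip) := by
        have e : a0 * (m * b1 - b0 * xI) * (a0 * (m * b2 - b0 * yI)) =
            a0 ^ 2 * ((m * b1 - b0 * xI) * (m * b2 - b0 * yI)) := by ring
        rw [e]; exact mul_le_mul_of_nonneg_left hIp hA2
      rcases lt_or_ge (b0 * a1 - a0 * b1) 0 with hEneg | hEpos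
      · -- E < 0 < E'
        have hE'pos : 0 < b0 * a2 - a0 * b2 := by
          by_contra hcon
          exact absurd (mul_nonneg_of_nonpos_of_nonpos hEneg.le (not_lt.mp hcon)) (not_le.mpr hEE)
        have hB : 0 ≤ -(b0 * a1 - a0 * b1) := by linarith
        have hA : 0 ≤ a0 * (m * b2 - b0 * yI) := mul_nonneg ha0 hy1
        -- m·(−E) ≤ a0 (m b1 − b0 xI): the ideal x-mean is below the world-0 x-mean
        have h1 : m * (-(b0 * a1 - a0 * b1)) ≤ a0 * (m * b1 - b0 * xI) := by
          have := mul_le_mul_of_nonneg_left hidx hb0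
          nlinarith [this]
        have h2 : (-(b0 * a1 - a0 * b1)) * ((b0 - g0) * (b0 * a2 - a0 * b2)) ≤
            (-(b0 * a1 - a0 * b1)) * (a0 * (m * b2 - b0 * yI)) :=
          mul_le_mul_of_nonneg_left hOMy hB
        have h3 : (m * (-(b0 * a1 - a0 * b1))) * (a0 * (m * b2 - b0 * yI)) ≤
            (a0 * (m * b1 - b0 * xI)) * (a0 * (m * b2 - b0 * yI)) :=
          mul_le_mul_of_nonneg_right h1 hA
        have h5 : 0 ≤ m * (a0 ^ 2 * Ip + (b0 - g0) * ((b0 * a1 - a0 * b1) * (b0 * a2 - a0 * b2))) := by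
          have e : m * (a0 ^ 2 * Ip + (b0 - g0) * ((b0 * a1 - a0 * b1) * (b0 * a2 - a0 * b2))) =
              a0 ^ 2 * (m * Ip) - m * ((-(b0 * a1 - a0 * b1)) * ((b0 - g0) * (b0 * a2 - a0 * b2))) := by
            ring
          rw [e]
          have h2m := mul_le_mul_of_nonneg_left h2 hm.le
          have e2 : m * ((-(b0 * a1 - a0 * b1)) * (a0 * (m * b2 - b0 * yI))) =
              (m * (-(b0 * a1 - a0 * b1))) * (a0 * (m * b2 - b0 * yI)) := by ring
          linarith [h2m, h3, h4, e2]
        exact (mul_nonneg_iff_of_pos_left hm).mp h5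
      · -- E ≥ 0 > E'
        have hE'neg : b0 * a2 - a0 * b2 < 0 := by
          by_contra hcon
          exact absurd (mul_nonneg hEpos (not_lt.mp hcon)) (not_le.mpr hEE)
        have hB : 0 ≤ -(b0 * a2 - a0 * b2) := by linarith
        have hA : 0 ≤ a0 * (m * b1 - b0 * xI) := mul_nonneg ha0 hx1
        have h1 : m * (-(b0 * a2 - a0 * b2)) ≤ a0 * (m * b2 - b0 * yI) := by
          have := mul_le_mul_of_nonneg_left hidy hb0
          nlinarith [this]
        have h2 : (-(b0 * a2 - a0 * b2)) * ((b0 - g0) * (b0 * a1 - a0 * b1)) ≤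
            (-(b0 * a2 - a0 * b2)) * (a0 * (m * b1 - b0 * xI)) :=
          mul_le_mul_of_nonneg_left hOMx hB
        have h3 : (m * (-(b0 * a2 - a0 * b2))) * (a0 * (m * b1 - b0 * xI)) ≤
            (a0 * (m * b2 - b0 * yI)) * (a0 * (m * b1 - b0 * xI)) :=
          mul_le_mul_of_nonneg_right h1 hA
        have h5 : 0 ≤ m * (a0 ^ 2 * Ip + (b0 - g0) * ((b0 * a1 - a0 * b1) * (b0 * a2 - a0 * b2))) := by
          have e : m * (a0 ^ 2 * Ip + (b0 - g0) * ((b0 * a1 - a0 * b1) * (b0 * a2 - a0 * b2))) =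
              a0 ^ 2 * (m * Ip) - m * ((-(b0 * a2 - a0 * b2)) * ((b0 - g0) * (b0 * a1 - a0 * b1))) := by
            ring
          rw [e]
          have h2m := mul_le_mul_of_nonneg_left h2 hm.le
          have e2 : m * ((-(b0 * a2 - a0 * b2)) * (a0 * (m * b1 - b0 * xI))) =
              (m * (-(b0 * a2 - a0 * b2))) * (a0 * (m * b1 - b0 * xI)) := by ring
          have e4 : (a0 * (m * b2 - b0 * yI)) * (a0 * (m * b1 - b0 * xI)) =
              a0 * (m * b1 - b0 * xI) * (a0 * (m * b2 - b0 * yI)) := by ring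
          linarith [h2m, h3, h4, e2, e4]
        exact (mul_nonneg_iff_of_pos_left hm).mp h5
  have e : a0 ^ 2 * (Ip + Dp) + (b0 - g0) * ((b0 * a1 - a0 * b1) * (b0 * a2 - a0 * b2)) =
      (a0 ^ 2 * Ip + (b0 - g0) * ((b0 * a1 - a0 * b1) * (b0 * a2 - a0 * b2))) + a0 ^ 2 * Dp := by ring
  rw [e]; exact add_nonneg key hDp'

end EnteredAlg

section EnteredMain

variable {V : Type*} [DecidableEq V] {R : Type*} [Field R] [LinearOrder R] [IsStrictOrderedRing R]

omit [DecidableEq V] [LinearOrder R] [IsStrictOrderedRing R] in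
/-- The expansion of a centred functional over any index set. -/
lemma centred_expand (G x y : Finset V → R) (S : Finset (Finset V)) (b0 b1 b2 : R) :
    ∑ W ∈ S, G W * ((b0 * x W - b1) * (b0 * y W - b2)) =
      b0 * b0 * (∑ W ∈ S, G W * (x W * y W)) - b0 * b2 * (∑ W ∈ S, G W * x W)
        - b0 * b1 * (∑ W ∈ S, G W * y W) + b1 * b2 * (∑ W ∈ S, G W) := by
  rw [Finset.mul_sum, Finset.mul_sum, Finset.mul_sum, Finset.mul_sum, ← Finset.sum_sub_distrib,
    ← Finset.sum_sub_distrib, ← Finset.sum_add_distrib]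
  exact Finset.sum_congr rfl (fun W _ => by ring)

set_option maxHeartbeats 400000 in
/-- **THE UNIVERSAL PURE CHAIN WHENEVER THE ENTERED PART OF THE GATE FUNCTIONAL IS NONNEGATIVE.**
Notation as in `pureChain_functional_nonneg_of_Qstar`; `hD` says that the entered clusters'
part of the world-1 gate functional centred at the world-1 `R`-means,
`∑_{W meets ent'} ν d' (b0 x − b1)(b0 y − b2)`, is nonnegative.  Then the pure chain functional is
nonnegative at EVERY `ρ ∈ [0, 1]` for every pair of nonnegative increasing markers. -/
theorem pureChain_functional_nonneg_of_enteredPart (U ent' : Finset V) (ν c d d' : Finset V → R)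
    (ρ : R) (hρ0 : 0 ≤ ρ) (hρ1 : ρ ≤ 1) (hν0 : ∀ W, 0 ≤ ν W)
    (hν : ∀ s ⊆ U, ∀ t ⊆ U, ν s * ν t ≤ ν (s ∩ t) * ν (s ∪ t))
    (hc0 : ∀ W, 0 ≤ c W) (hd0 : ∀ W, 0 ≤ d W) (hd'0 : ∀ W, 0 ≤ d' W)
    (hdc : ∀ W, d W ≤ c W) (hd'c : ∀ W, d' W ≤ c W) (hd'd : ∀ W, d' W ≤ d W)
    (hcc : ∀ s t, c s * c t ≤ c (s ∩ t) * c (s ∪ t))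
    (hdd : ∀ s t, d s * d t ≤ d (s ∩ t) * d (s ∪ t))
    (hd'd' : ∀ s t, d' s * d' t ≤ d' (s ∩ t) * d' (s ∪ t))
    (hcd : ∀ s t, c s * d t ≤ c (s ∩ t) * d (s ∪ t))
    (hcd' : ∀ s t, c s * d' t ≤ c (s ∩ t) * d' (s ∪ t))
    (hdd' : ∀ s t, d s * d' t ≤ d (s ∩ t) * d' (s ∪ t))
    (hratio : ∀ s t, s ⊆ t → d s * c t ≤ c s * d t)
    (hratio' : ∀ s t, s ⊆ t → d' s * c t ≤ c s * d' t)
    (x y : Finset V → R) (hx0 : ∀ W, 0 ≤ x W) (hy0 : ∀ W, 0 ≤ y W)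
    (hxm : ∀ s t, x s ≤ x (s ∪ t)) (hym : ∀ s t, y s ≤ y (s ∪ t))
    (hpos0 : 0 < ∑ W ∈ U.powerset, ν W * c W)
    (hpos1 : 0 < ∑ W ∈ U.powerset, ν W * chainMix ∅ ent' 1 c d W)
    (hmI : 0 < ∑ W ∈ U.powerset.filter (fun W => ¬ ∃ r ∈ ent', r ∈ W), ν W * c W)
    (hD : 0 ≤ ∑ W ∈ U.powerset.filter (fun W => ∃ r ∈ ent', r ∈ W), ν W * d' W *
        (((∑ W ∈ U.powerset, ν W * chainMix ∅ ent' 1 c d W) * x W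
            - (∑ W ∈ U.powerset, ν W * chainMix ∅ ent' 1 c d W * x W)) *
          ((∑ W ∈ U.powerset, ν W * chainMix ∅ ent' 1 c d W) * y W
            - (∑ W ∈ U.powerset, ν W * chainMix ∅ ent' 1 c d W * y W)))) :
    0 ≤ (∑ W ∈ U.powerset, ν W * chainMix ∅ ent' ρ c d W) ^ 2 *
          (∑ W ∈ U.powerset, ν W * chainMix ∅ ent' ρ c d' W * (x W * y W))
        - (∑ W ∈ U.powerset, ν W * chainMix ∅ ent' ρ c d W) *
          (∑ W ∈ U.powerset, ν W * chainMix ∅ ent' ρ c d W * x W) *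
          (∑ W ∈ U.powerset, ν W * chainMix ∅ ent' ρ c d' W * y W)
        - (∑ W ∈ U.powerset, ν W * chainMix ∅ ent' ρ c d W) *
          (∑ W ∈ U.powerset, ν W * chainMix ∅ ent' ρ c d W * y W) *
          (∑ W ∈ U.powerset, ν W * chainMix ∅ ent' ρ c d' W * x W)
        + (∑ W ∈ U.powerset, ν W * chainMix ∅ ent' ρ c d W * x W) *
          (∑ W ∈ U.powerset, ν W * chainMix ∅ ent' ρ c d W * y W) *
          (∑ W ∈ U.powerset, ν W * chainMix ∅ ent' ρ c d' W) := by
  -- names for the moments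
  set a0 := ∑ W ∈ U.powerset, ν W * c W with ha0
  set a1 := ∑ W ∈ U.powerset, ν W * c W * x W with ha1
  set a2 := ∑ W ∈ U.powerset, ν W * c W * y W with ha2
  set b0 := ∑ W ∈ U.powerset, ν W * chainMix ∅ ent' 1 c d W with hb0
  set b1 := ∑ W ∈ U.powerset, ν W * chainMix ∅ ent' 1 c d W * x W with hb1
  set b2 := ∑ W ∈ U.powerset, ν W * chainMix ∅ ent' 1 c d W * y W with hb2'
  set g0 := ∑ W ∈ U.powerset, ν W * chainMix ∅ ent' 1 c d' W with hg0
  set g1 := ∑ W ∈ U.powerset, ν W * chainMix ∅ ent' 1 c d' W * x W with hg1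
  set g2 := ∑ W ∈ U.powerset, ν W * chainMix ∅ ent' 1 c d' W * y W with hg2
  set g12 := ∑ W ∈ U.powerset, ν W * chainMix ∅ ent' 1 c d' W * (x W * y W) with hg12
  set m := ∑ W ∈ U.powerset.filter (fun W => ¬ ∃ r ∈ ent', r ∈ W), ν W * c W with hm
  set xI := ∑ W ∈ U.powerset.filter (fun W => ¬ ∃ r ∈ ent', r ∈ W), ν W * c W * x W with hxI
  set yI := ∑ W ∈ U.powerset.filter (fun W => ¬ ∃ r ∈ ent', r ∈ W), ν W * c W * y W with hyI
  set xyI := ∑ W ∈ U.powerset.filter (fun W => ¬ ∃ r ∈ ent', r ∈ W), ν W * c W * (x W * y W) with hxyI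
  -- the entered parts of the three laws
  set M := ∑ W ∈ U.powerset.filter (fun W => ∃ r ∈ ent', r ∈ W), ν W * c W with hM
  set xM := ∑ W ∈ U.powerset.filter (fun W => ∃ r ∈ ent', r ∈ W), ν W * c W * x W with hxM
  set yM := ∑ W ∈ U.powerset.filter (fun W => ∃ r ∈ ent', r ∈ W), ν W * c W * y W with hyM
  set r := ∑ W ∈ U.powerset.filter (fun W => ∃ r ∈ ent', r ∈ W), ν W * d W with hr
  set xr := ∑ W ∈ U.powerset.filter (fun W => ∃ r ∈ ent', r ∈ W), ν W * d W * x W with hxr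
  set yr := ∑ W ∈ U.powerset.filter (fun W => ∃ r ∈ ent', r ∈ W), ν W * d W * y W with hyr
  set g := ∑ W ∈ U.powerset.filter (fun W => ∃ r ∈ ent', r ∈ W), ν W * d' W with hg
  -- the two parts of the world-1 functional
  set Ip := ∑ W ∈ U.powerset.filter (fun W => ¬ ∃ r ∈ ent', r ∈ W), ν W * c W *
    ((b0 * x W - b1) * (b0 * y W - b2)) with hIpdef
  set Dp := ∑ W ∈ U.powerset.filter (fun W => ∃ r ∈ ent', r ∈ W), ν W * d' W *
    ((b0 * x W - b1) * (b0 * y W - b2)) with hDpdef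
  -- splitting the global sums into ideal + entered parts
  have hsplit : ∀ f : Finset V → R, (∑ W ∈ U.powerset, f W) =
      (∑ W ∈ U.powerset.filter (fun W => ¬ ∃ r ∈ ent', r ∈ W), f W) +
        (∑ W ∈ U.powerset.filter (fun W => ∃ r ∈ ent', r ∈ W), f W) := by
    intro f; rw [add_comm, Finset.sum_filter_add_sum_filter_not]
  have hmeet : ∀ W : Finset V, (∃ r ∈ ent', r ∈ W) → chainMix ∅ ent' 1 c d W = d W := by
    intro W hW
    apply chainMix_one_of_meet
    obtain ⟨r', hr', hrW⟩ := hW; exact ⟨r', by simpa using hr', hrW⟩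
  have hmeet' : ∀ W : Finset V, (∃ r ∈ ent', r ∈ W) → chainMix ∅ ent' 1 c d' W = d' W := by
    intro W hW
    apply chainMix_one_of_meet
    obtain ⟨r', hr', hrW⟩ := hW; exact ⟨r', by simpa using hr', hrW⟩
  have hnomeet : ∀ W : Finset V, (¬ ∃ r ∈ ent', r ∈ W) → chainMix ∅ ent' 1 c d W = c W := by
    intro W hW
    apply chainMix_of_not_meet
    rintro ⟨r', hr', hrW⟩; exact hW ⟨r', by simpa using hr', hrW⟩
  have hnomeet' : ∀ W : Finset V, (¬ ∃ r ∈ ent', r ∈ W) → chainMix ∅ ent' 1 c d' W = c W := by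
    intro W hW
    apply chainMix_of_not_meet
    rintro ⟨r', hr', hrW⟩; exact hW ⟨r', by simpa using hr', hrW⟩
  have ea0 : a0 = m + M := hsplit _
  have ea1 : a1 = xI + xM := hsplit _
  have ea2 : a2 = yI + yM := hsplit _
  have eb0 : b0 = m + r := by
    rw [hb0, hsplit]
    congr 1
    · exact Finset.sum_congr rfl fun W hW => by rw [hnomeet W (Finset.mem_filter.1 hW).2]
    · exact Finset.sum_congr rfl fun W hW => by rw [hmeet W (Finset.mem_filter.1 hW).2]
  have eb1 : b1 = xI + xr := by
    rw [hb1, hsplit]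
    congr 1
    · exact Finset.sum_congr rfl fun W hW => by rw [hnomeet W (Finset.mem_filter.1 hW).2]
    · exact Finset.sum_congr rfl fun W hW => by rw [hmeet W (Finset.mem_filter.1 hW).2]
  have eb2 : b2 = yI + yr := by
    rw [hb2', hsplit]
    congr 1
    · exact Finset.sum_congr rfl fun W hW => by rw [hnomeet W (Finset.mem_filter.1 hW).2]
    · exact Finset.sum_congr rfl fun W hW => by rw [hmeet W (Finset.mem_filter.1 hW).2]
  have eg0 : g0 = m + g := by
    rw [hg0, hsplit]
    congr 1
    · exact Finset.sum_congr rfl fun W hW => by rw [hnomeet' W (Finset.mem_filter.1 hW).2]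
    · exact Finset.sum_congr rfl fun W hW => by rw [hmeet' W (Finset.mem_filter.1 hW).2]
  -- the world-1 functional is the ideal part plus the entered part
  have eU : b0 * b0 * g12 - b0 * b2 * g1 - b0 * b1 * g2 + b1 * b2 * g0 = Ip + Dp := by
    have e1 : ∑ W ∈ U.powerset, ν W * chainMix ∅ ent' 1 c d' W * ((b0 * x W - b1) * (b0 * y W - b2))
        = Ip + Dp := by
      rw [hsplit]
      congr 1
      · exact Finset.sum_congr rfl fun W hW => by rw [hnomeet' W (Finset.mem_filter.1 hW).2]
      · exact Finset.sum_congr rfl fun W hW => by rw [hmeet' W (Finset.mem_filter.1 hW).2]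
    rw [← e1, centred_expand]
  -- the ideal part expanded, and FKG on the ideal
  have eIp : Ip = b0 * b0 * xyI - b0 * b2 * xI - b0 * b1 * yI + b1 * b2 * m := by
    rw [hIpdef, centred_expand]
  have hL₀0 : ∀ W, 0 ≤ ν W * c W := fun W => mul_nonneg (hν0 W) (hc0 W)
  have hFKG_I : xI * yI ≤ m * xyI := by
    rw [hxI, hyI, hm, hxyI]
    simp only [Finset.sum_filter]
    have n₁ : ∀ W, (0 : R) ≤ (if ¬ ∃ r ∈ ent', r ∈ W then ν W * c W * x W else 0) := fun W => by
      split_ifs <;> first | exact le_rfl | exact mul_nonneg (hL₀0 W) (hx0 W)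
    have n₂ : ∀ W, (0 : R) ≤ (if ¬ ∃ r ∈ ent', r ∈ W then ν W * c W * y W else 0) := fun W => by
      split_ifs <;> first | exact le_rfl | exact mul_nonneg (hL₀0 W) (hy0 W)
    have n₃ : ∀ W, (0 : R) ≤ (if ¬ ∃ r ∈ ent', r ∈ W then ν W * c W else 0) := fun W => by
      split_ifs <;> first | exact le_rfl | exact hL₀0 W
    have n₄ : ∀ W, (0 : R) ≤ (if ¬ ∃ r ∈ ent', r ∈ W then ν W * c W * (x W * y W) else 0) :=
      fun W => by
        split_ifs <;> first | exact le_rfl | exact mul_nonneg (hL₀0 W) (mul_nonneg (hx0 W) (hy0 W))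
    refine ad_pointwise U _ _ _ _ n₁ n₂ n₃ n₄ ?_
    intro s hs t ht
    by_cases h1 : ¬ ∃ r ∈ ent', r ∈ s
    · by_cases h2 : ¬ ∃ r ∈ ent', r ∈ t
      · have h3 : ¬ ∃ r ∈ ent', r ∈ s ∩ t := by
          rintro ⟨r', hr', hrst⟩; exact h1 ⟨r', hr', (Finset.mem_inter.1 hrst).1⟩
        have h4 : ¬ ∃ r ∈ ent', r ∈ s ∪ t := by
          rintro ⟨r', hr', hrst⟩
          rcases Finset.mem_union.1 hrst with hs' | ht'
          · exact h1 ⟨r', hr', hs'⟩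
          · exact h2 ⟨r', hr', ht'⟩
        rw [if_pos h1, if_pos h2, if_pos h3, if_pos h4]
        have e1 : ν s * ν t ≤ ν (s ∩ t) * ν (s ∪ t) := hν s hs t ht
        have e2 := hcc s t
        have e3 := hxm s t
        have e4 : y t ≤ y (s ∪ t) := by rw [Finset.union_comm]; exact hym t s
        calc ν s * c s * x s * (ν t * c t * y t)
            = (ν s * ν t) * (c s * c t) * (x s * y t) := by ring
          _ ≤ (ν (s ∩ t) * ν (s ∪ t)) * (c (s ∩ t) * c (s ∪ t)) * (x (s ∪ t) * y (s ∪ t)) := by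
              apply mul_le_mul (mul_le_mul e1 e2 (mul_nonneg (hc0 _) (hc0 _))
                (mul_nonneg (hν0 _) (hν0 _)))
                (mul_le_mul e3 e4 (hy0 _) (hx0 _)) (mul_nonneg (hx0 _) (hy0 _))
                (mul_nonneg (mul_nonneg (hν0 _) (hν0 _)) (mul_nonneg (hc0 _) (hc0 _)))
          _ = ν (s ∩ t) * c (s ∩ t) * (ν (s ∪ t) * c (s ∪ t) * (x (s ∪ t) * y (s ∪ t))) := by ring
      · rw [if_neg h2, mul_zero]; exact mul_nonneg (n₃ _) (n₄ _)
    · rw [if_neg h1, zero_mul]; exact mul_nonneg (n₃ _) (n₄ _)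
  have hIp : (m * b1 - b0 * xI) * (m * b2 - b0 * yI) ≤ m * Ip := by
    rw [eIp]
    have e : m * (b0 * b0 * xyI - b0 * b2 * xI - b0 * b1 * yI + b1 * b2 * m)
        - (m * b1 - b0 * xI) * (m * b2 - b0 * yI) = b0 * b0 * (m * xyI - xI * yI) := by ring
    have : 0 ≤ b0 * b0 * (m * xyI - xI * yI) :=
      mul_nonneg (mul_nonneg hpos1.le hpos1.le) (by linarith)
    linarith
  -- the one-marker bounds in the global form
  have hOMy_raw := one_marker_bound U ent' ν c d d' y hν0 hν hc0 hd0 hd'0 hd'd hdd hcd hy0 hym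
  have hOMx_raw := one_marker_bound U ent' ν c d d' x hν0 hν hc0 hd0 hd'0 hd'd hdd hcd hx0 hxm
  have hOMy : (b0 - g0) * (b0 * a2 - a0 * b2) ≤ a0 * (m * b2 - b0 * yI) := by
    rw [ea0, ea2, eb0, eb2, eg0]
    refine le_of_mul_le_mul_left ?_ hmI
    calc m * ((m + r - (m + g)) * ((m + r) * (yI + yM) - (m + M) * (yI + yr)))
        = (r - g) * (m * (yI * (r - M) + yM * (m + r) - yr * (m + M))) := by ring
      _ ≤ m * (m + M) * (yr * m - yI * r) := hOMy_raw
      _ = m * ((m + M) * (m * (yI + yr) - (m + r) * yI)) := by ring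
  have hOMx : (b0 - g0) * (b0 * a1 - a0 * b1) ≤ a0 * (m * b1 - b0 * xI) := by
    rw [ea0, ea1, eb0, eb1, eg0]
    refine le_of_mul_le_mul_left ?_ hmI
    calc m * ((m + r - (m + g)) * ((m + r) * (xI + xM) - (m + M) * (xI + xr)))
        = (r - g) * (m * (xI * (r - M) + xM * (m + r) - xr * (m + M))) := by ring
      _ ≤ m * (m + M) * (xr * m - xI * r) := hOMx_raw
      _ = m * ((m + M) * (m * (xI + xr) - (m + r) * xI)) := by ring
  -- the ideal means below the world-0 and the world-1 means
  have hidx : a0 * xI ≤ m * a1 := by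
    have := ideal_le_global U ent' ν c x hν0 hν hc0 hcc hx0 hxm
    rw [mul_comm]; exact this
  have hidy : a0 * yI ≤ m * a2 := by
    have := ideal_le_global U ent' ν c y hν0 hν hc0 hcc hy0 hym
    rw [mul_comm]; exact this
  have hqx : b0 * xI ≤ m * b1 := by
    have h := ideal_le_entered_R U ent' ν c d x hν0 hν hc0 hd0 hcd hx0 hxm
    rw [eb0, eb1]
    calc (m + r) * xI = m * xI + xI * r := by ring
      _ ≤ m * xI + m * xr := by linarith [h]
      _ = m * (xI + xr) := by ring
  have hqy : b0 * yI ≤ m * b2 := by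
    have h := ideal_le_entered_R U ent' ν c d y hν0 hν hc0 hd0 hcd hy0 hym
    rw [eb0, eb2]
    calc (m + r) * yI = m * yI + yI * r := by ring
      _ ≤ m * yI + m * yr := by linarith [h]
      _ = m * (yI + yr) := by ring
  have hP : 0 ≤ b0 - g0 := by
    rw [hb0, hg0]
    have : g0 ≤ b0 := Finset.sum_le_sum fun W _ =>
      mul_le_mul_of_nonneg_left (chainMix_one_mono ∅ ent' hd'd W) (hν0 W)
    linarith
  -- (Q′)
  have hQ0 := qprime_of_enteredPart_alg a0 a1 a2 b0 b1 b2 g0 m xI yI Ip Dp hmI hpos0.le hpos1.le hP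
    hD hIp hOMx hOMy hidx hidy hqx hqy
  rw [← eU] at hQ0
  exact pureChain_functional_nonneg_of_Qprime U ent' ν c d d' ρ hρ0 hρ1 hν0 hν hc0 hd0 hd'0 hdc hd'c
    hcc hdd hd'd' hcd hcd' hdd' hratio hratio' x y hx0 hy0 hxm hym hpos0 hpos1 hQ0

end EnteredMain

end Summit.Ventures.PercRepro2.Coin
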